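import Literature.NumberTheory.LFunctions.Zhang2022.KnifeEdgeWallBand

/-!
# Zhang (2022), rung F-S3 (Landau–Siegel programme, family B-multi, class M3): registry rows E-006 «E*-cross» and
# E-035 «E-cross-neg(κ)» at the DISCRETE-MEAN level — the polar discrete pairing, the bulk/band split of a wall
# design, Cauchy–Schwarz subordination of the cross term PROVED at every modulus, and the two rows as bare `Prop`s

Y. Zhang, *Discrete mean estimates and the Landau–Siegel zero*, arXiv:2211.02515v1 [Zhang2022LandauSiegel] —
an unrefereed manuscript under adjudication. **WHAT THIS IS NOT: not a claim about Theorems 1–2 of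
arXiv:2211.02515, about Landau–Siegel zeros, or about Parity. The programme SEARCHES and TYPES; nothing here
asserts any estimate: `ECrossBandAsymp`, `ECrossBand` (registry E-006) and `ECrossNegDiscrete` (registry E-035) are
bare `Prop`s; every `theorem` is either finite-sum algebra about Zhang's discrete mean (valid at EVERY modulus, no
asymptotics) or an implication between those `Prop`s and the named nodes of `SkeletonPropositions`.**

**Objects (Part 1).** The POLAR discrete pairing `discPolar c' χ F G = Σ_{(ψ,ρ)} (Re 𝔠*·Re ω)·F·conj G` of two
value tables — the sesquilinear form whose diagonal is `KnifeEdge.discMean` (`KnifeEdgeEStarLen.lean` Part 1; the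
free-scale twin with the full complex weights is `EllScales.discPolar`), with `discMean_add`:
`Ξ(F+G) = Ξ(F) + Ξ(G) + 2Re Ξ(F,G)`. The BULK/BAND SPLIT of a wall design (`KnifeEdgeWallBand.wallProfile`):
`wallProfile ρ α u W = inClassExt u + bandProfile ρ α W` pointwise (`wallProfile_eq_add`), hence — `profPoly` being
linear in the profile (`profPoly_add`) — the design's value table is `wallBulkPoly + wallBandPoly` and its discrete
mean is `bulk + band + 2Re cross` (`discMean_wallDesign`), the cross being `discPolar (wallBulkPoly) (wallBandPoly)`:
THE object of registry row E-006 for a wall design (FEASIBILITY.md v1.0b §0.6 «the bulk × band CROSS term for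
`g(1) ≠ 0`»; after Zhang's Lemma 8.1 a correlation of Kloosterman sums `S(1,a;p)` to the prime modulus `p` against
the bulk coefficients of length `≍ Pt₀ ≥ p^{3/4+ε}`).

**PROVED at every `(D, χ)` (Part 2) — the (B1) mechanism for the wall class, no asymptotics, no (A):** if the weights
`Re 𝔠*(ρ,ψ)·Re ω(ρ)` are `≥ 0` on the index set (Lemma 2.3 + Prop. 2.2 (i): `KnifeEdge.weights_nonneg_of`), then
`|Ξ(F,G)|² ≤ Ξ(F)·Ξ(G)` (`norm_sq_discPolar_le`, weighted Cauchy–Schwarz) and therefore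
`Ξ(F+G) ≥ (√Ξ(F) − √Ξ(G))²` (`sq_sqrt_sub_sqrt_le_discMean_add`): the cross term can lower a wall design's discrete
mean at most to the Cauchy–Schwarz floor, never below `0`. This is ls-ref-1's pricing sentence for E-035 («(B1)-excluded
at main order: the (bulk, band) 2×2 block of a PSD form is PSD, `|cross|² ≤ 𝔅(u)·V`», INBOX 16:48:04Z) as a
kernel theorem about the DISCRETE form; what it leaves to the dictionary is only whether the three (A)-world main
terms (`𝔅(u)`, `V`, `X` of `KnifeEdgeWallBand.EMultiBand`) are honest limits of `Ξ(bulk)`, `Ξ(band)`, `Ξ(bulk, band)`.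

**The rows (Part 3, bare `Prop`s).** E-006 in asymptotic form with a slot, `ECrossBandAsymp c' Λ X`: under (A) the
cross pairing of the realised (balanced) wall design is `X(u,W)·𝔞𝔓 + o(𝔞𝔓)`; the registry's expected form «cross
= `o(𝔅-scale)`» is the instance `X = 0`, `ECrossBand c' Λ` (status open-in-print-adjacent; NEAREST PRINT, typed:
`Lit.fouvryKowalskiMichel2014_theorem117_typeII/_typeI`, `Lit.fouvryKowalskiMichel2014_corollary113`,
`Lit.kowalskiMichelSawin2017_theorem11/13` (`BilinearKloostermanSumsPrimeModulus.lean`, p456463) and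
`Lit.fouvryKowalskiMichel2014_theorem15/17/115/116` (`TraceWeightsOverPrimes.lean`, p456288) — Kloosterman-sum
correlations to ONE prime modulus, non-trivial for coefficient length `≥ p^{3/4+ε}` resp. below the Pólya–Vinogradov
range; price sheet lit/START-HERE.md SH-076: at one prime modulus such technology saves `5/512 … 1/20` and buys length
`≈ q^{0.008}` — NONE of it is an estimate of THIS cross term: Zhang's coefficients, Gaussian weights and the average over
the prime window `p ∈ (P, P(1+𝓛⁻⁶⁸))` differ). E-035 at the discrete level, `ECrossNegDiscrete c' κ Λ`: some wall
design whose cross pairing is `≤ −κ·Ξ(bulk)` at band saturation `Ξ(band) = Ξ(bulk) > 0`, under (A), for all large `D`.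
**PROVED (Part 4):** for `κ > 2` this contradicts Cauchy–Schwarz wherever the weights are `≥ 0`, so together with
Prop. 2.2 (i) and Lemma 2.3 it forces `¬(A)` for all large `D` — `theorem1_of_crossNegDiscrete`: **E-035 (κ > 2) is by
itself as strong as the whole endgame** (it is a `¬(A)` statement in disguise), which is the typed content of its price
«XL, (B1)-excluded»; and `eCrossBandAsymp_cs`: slot consistency — if bulk, band and cross all have (A)-world limits
(`EMultiBand`-type rows for `Ξ(bulk)`, `Ξ(band)` and `ECrossBandAsymp` for the cross) at some `(D,χ)` where (A) holds
and the weights are `≥ 0`, the limits inherit `|X|² ≤ 𝔅·V` up to the errors (stated as the finite inequality it is).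

Deliberately NOT here: any derivation of `X` (row E-006 stays «open-in-print-adjacent / derivation»); the band law itself
(E-005/E-034: `KnifeEdgeWallBand.lean`, p458037); interior jumps (E-028), the Λ-block (E-030), far jumps (E-033,
`KnifeEdgeInvisibleTail.tailInvisible_bv`, p457577).
References: Zhang, arXiv:2211.02515v1, §2 (2.14)–(2.20), Lemma 2.3, Prop. 2.2 (i), (2.17) (the polar mean `Ξ₁*`);
§7 Prop 7.1 (7.2); §8 (8.3), (8.5), Lemma 8.1 [cite: Zhang2022LandauSiegel, §2 (2.17), §8 (8.5), Lemma 8.1]; cell files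
OBJECTIVE.md §3.3, obj/EDREGISTRY.md rows E-006/E-035, B-multi/EDLIST.md v1.1, B-multi/PLAN.md §1/§9,
zhang-knife FEASIBILITY.md v1.0b §0.6, ls-ref-1 VERDICTS.md §4 (prices). «The programme SEARCHES and TYPES; no claim
about Landau–Siegel zeros, Theorems 1–2 of arXiv:2211.02515 or a repaired Margin232 until a kernel theorem says so.»
-/

noncomputable section

open Complex Real Set ComplexConjugate
open _root_.MeasureTheory

namespace Literature.NumberTheory.LFunctions.Zhang2022

namespace KnifeEdge

open Repair Skeleton

variable (c' : ℝ) {D : ℕ} (χ : DirichletCharacter ℂ D)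

/-! ### Part 1 — the polar discrete pairing and the bulk/band split of a wall design -/

/-- **The polar discrete pairing** `Ξ(F,G) = Σ_{(ψ,ρ) ∈ idx χ} (Re 𝔠*(ρ,ψ)·Re ω(ρ))·F(ψ,ρ)·conj G(ψ,ρ)` — the
sesquilinear form on value tables whose diagonal is `KnifeEdge.discMean` (`discPolar_self_re`); the shape of the
manuscript's `Ξ₁*` (2.17) / `Ξ₁₃` (8.5) with the weights in the real form of `KnifeEdge.discMean`.
[cite: Zhang2022LandauSiegel, §2 (2.17), §8 (8.5)] -/
def discPolar (F G : Chr D → ℂ → ℂ) : ℂ :=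
  ∑ i ∈ idx χ, (((cstar c' D i.1 i.2).re * (omegaW D i.2).re : ℝ) : ℂ) * (F i.1 i.2 * conj (G i.1 i.2))

variable {c' χ}

/-- On the diagonal the polar pairing is the discrete mean: `Re Ξ(F,F) = Ξ(F)`.
[cite: Zhang2022LandauSiegel, §2 (2.16)–(2.17)] -/
theorem discPolar_self_re (F : Chr D → ℂ → ℂ) : (discPolar c' χ F F).re = discMean c' χ F := by
  unfold discPolar discMean
  rw [Complex.re_sum]
  refine Finset.sum_congr rfl fun i _ => ?_
  rw [Complex.re_ofReal_mul, Complex.mul_conj, Complex.ofReal_re, ← Complex.sq_norm]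
  ring

/-- **Polarisation:** `Ξ(F + G) = Ξ(F) + Ξ(G) + 2Re Ξ(F,G)` (finite-sum algebra, every modulus).
[cite: Zhang2022LandauSiegel, §2 (2.16)–(2.17)] -/
theorem discMean_add (F G : Chr D → ℂ → ℂ) :
    discMean c' χ (fun x s => F x s + G x s) =
      discMean c' χ F + discMean c' χ G + 2 * (discPolar c' χ F G).re := by
  unfold discMean discPolar
  rw [Complex.re_sum, Finset.mul_sum, ← Finset.sum_add_distrib, ← Finset.sum_add_distrib]
  refine Finset.sum_congr rfl fun i _ => ?_
  rw [Complex.re_ofReal_mul, Complex.sq_norm, Complex.sq_norm, Complex.sq_norm, Complex.normSq_add]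
  ring

/-- The in-class piece extended by `0` beyond the wall: `u·𝟙_{z ≤ 1}` (the BULK of a wall design).
[cite: Zhang2022LandauSiegel, §7 Prop 7.1 (7.2)] -/
def inClassExt (u : ℝ → ℂ) : ℝ → ℂ := fun z => if z ≤ 1 then u z else 0

/-- The band piece of a wall design alone: `ρ·h⁺·b((z−1)/α)` on `1 < z ≤ 1 + α`, `0` elsewhere.
[cite: Zhang2022LandauSiegel, §2 (2.30)] -/
def bandProfile (ρ α : ℝ) (W : WallData) : ℝ → ℂ := fun z =>
  if z ≤ 1 then 0 else if z ≤ 1 + α then (ρ : ℂ) * W.hPlus * W.band ((z - 1) / α) else 0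

/-- **Bulk/band split of the realised profile:** `wallProfile ρ α u W = inClassExt u + bandProfile ρ α W`.
[cite: Zhang2022LandauSiegel, §2 (2.30), §7 (7.2)] -/
theorem wallProfile_eq_add (ρ α : ℝ) (u : ℝ → ℂ) (W : WallData) :
    wallProfile ρ α u W = fun z => inClassExt u z + bandProfile ρ α W z := by
  funext z
  unfold wallProfile inClassExt bandProfile
  split_ifs <;> simp

/-- `profPoly` is additive in the profile. [cite: Zhang2022LandauSiegel, §2 (2.23)–(2.25)] -/
theorem profPoly_add (x : Chr D) (g₁ g₂ : ℝ → ℂ) (N : ℕ) (s : ℂ) :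
    profPoly χ x (fun z => g₁ z + g₂ z) N s = profPoly χ x g₁ N s + profPoly χ x g₂ N s := by
  unfold profPoly
  rw [← Finset.sum_add_distrib]
  exact Finset.sum_congr rfl fun n _ => by ring

variable (χ) in
/-- The BULK value table of a wall design at modulus `D`: the profile polynomial of `inClassExt u` of length
`⌈P^{1+α̃(D)}⌉` (only `n ≤ P` contribute). [cite: Zhang2022LandauSiegel, §7 (7.2), §8 (8.3)] -/
def wallBulkPoly (u : ℝ → ℂ) : Chr D → ℂ → ℂ :=
  fun x s => profPoly χ x (inClassExt u) ⌈bigP D ^ (1 + alphaTilde D)⌉₊ s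

variable (χ) in
/-- The BAND value table of a wall design at modulus `D` in the balanced reading (band height
`h⁺·Λ(D,χ)^{−1/2}`, width `α̃(D)`): the profile polynomial of `bandProfile`, same length — coefficients supported on
the band `P < n ≤ P·Dt₀`. [cite: Zhang2022LandauSiegel, §2 (2.30), §8 Lemma 8.1] -/
def wallBandPoly (Λ : BandScale) (W : WallData) : Chr D → ℂ → ℂ :=
  fun x s => profPoly χ x (bandProfile ((Λ D χ) ^ (-(1 / 2 : ℝ))) (alphaTilde D) W)
    ⌈bigP D ^ (1 + alphaTilde D)⌉₊ s

/-- **The value table of a wall design is bulk + band**, pointwise. [cite: Zhang2022LandauSiegel, §2 (2.30), §7 (7.2)] -/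
theorem profPoly_wallProfile (Λ : BandScale) (u : ℝ → ℂ) (W : WallData) (x : Chr D) (s : ℂ) :
    profPoly χ x (wallProfile ((Λ D χ) ^ (-(1 / 2 : ℝ))) (alphaTilde D) u W) ⌈bigP D ^ (1 + alphaTilde D)⌉₊ s
      = wallBulkPoly χ u x s + wallBandPoly χ Λ W x s := by
  rw [wallProfile_eq_add, profPoly_add]
  rfl

/-- **The discrete mean of a wall design = bulk + band + 2Re cross**, the cross being the polar pairing of the bulk
and band tables (registry E-006's object). [cite: Zhang2022LandauSiegel, §2 (2.16)–(2.17), §8 Lemma 8.1] -/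
theorem discMean_wallDesign (Λ : BandScale) (u : ℝ → ℂ) (W : WallData) :
    discMean c' χ (fun x s =>
        profPoly χ x (wallProfile ((Λ D χ) ^ (-(1 / 2 : ℝ))) (alphaTilde D) u W)
          ⌈bigP D ^ (1 + alphaTilde D)⌉₊ s)
      = discMean c' χ (wallBulkPoly χ u) + discMean c' χ (wallBandPoly χ Λ W)
          + 2 * (discPolar c' χ (wallBulkPoly χ u) (wallBandPoly χ Λ W)).re := by
  simp_rw [profPoly_wallProfile]
  exact discMean_add _ _

/-! ### Part 2 — PROVED at every modulus: the cross term is Cauchy–Schwarz-subordinate ((B1) for the wall class) -/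

/-- **Weighted Cauchy–Schwarz for the discrete form:** with weights `Re 𝔠*·Re ω ≥ 0` on `idx χ`,
`|Ξ(F,G)|² ≤ Ξ(F)·Ξ(G)` — at EVERY modulus, for arbitrary value tables; no asymptotics, no (A).
[cite: Zhang2022LandauSiegel, §2 Lemma 2.3, (2.15)–(2.17)] -/
theorem norm_sq_discPolar_le (hw : ∀ i ∈ idx χ, 0 ≤ (cstar c' D i.1 i.2).re * (omegaW D i.2).re)
    (F G : Chr D → ℂ → ℂ) :
    ‖discPolar c' χ F G‖ ^ 2 ≤ discMean c' χ F * discMean c' χ G := by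
  set w : ((_ : Chr D) × ℂ) → ℝ := fun i => (cstar c' D i.1 i.2).re * (omegaW D i.2).re with hw_def
  -- termwise bound on the norm
  have h1 : ‖discPolar c' χ F G‖ ≤ ∑ i ∈ idx χ, w i * ‖F i.1 i.2‖ * ‖G i.1 i.2‖ := by
    unfold discPolar
    refine (norm_sum_le _ _).trans (le_of_eq (Finset.sum_congr rfl fun i hi => ?_))
    rw [norm_mul, norm_mul, Complex.norm_real, Real.norm_eq_abs, abs_of_nonneg (hw i hi),
      Complex.norm_conj]
    simp only [hw_def]
    ring
  -- Cauchy–Schwarz on the real weighted sums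
  have h2 : (∑ i ∈ idx χ, w i * ‖F i.1 i.2‖ * ‖G i.1 i.2‖) ^ 2 ≤
      (∑ i ∈ idx χ, w i * ‖F i.1 i.2‖ ^ 2) * ∑ i ∈ idx χ, w i * ‖G i.1 i.2‖ ^ 2 := by
    refine Finset.sum_sq_le_sum_mul_sum_of_sq_le_mul (idx χ)
      (fun i hi => mul_nonneg (hw i hi) (sq_nonneg _)) (fun i hi => mul_nonneg (hw i hi) (sq_nonneg _))
      (fun i _ => le_of_eq ?_)
    ring
  have h0 : 0 ≤ ∑ i ∈ idx χ, w i * ‖F i.1 i.2‖ * ‖G i.1 i.2‖ :=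
    Finset.sum_nonneg fun i hi => mul_nonneg (mul_nonneg (hw i hi) (norm_nonneg _)) (norm_nonneg _)
  have h3 : ‖discPolar c' χ F G‖ ^ 2 ≤ (∑ i ∈ idx χ, w i * ‖F i.1 i.2‖ * ‖G i.1 i.2‖) ^ 2 :=
    pow_le_pow_left₀ (norm_nonneg _) h1 2
  have hF : ∑ i ∈ idx χ, w i * ‖F i.1 i.2‖ ^ 2 = discMean c' χ F := by
    unfold discMean; exact Finset.sum_congr rfl fun i _ => by simp only [hw_def]; ring
  have hG : ∑ i ∈ idx χ, w i * ‖G i.1 i.2‖ ^ 2 = discMean c' χ G := by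
    unfold discMean; exact Finset.sum_congr rfl fun i _ => by simp only [hw_def]; ring
  calc ‖discPolar c' χ F G‖ ^ 2 ≤ (∑ i ∈ idx χ, w i * ‖F i.1 i.2‖ * ‖G i.1 i.2‖) ^ 2 := h3
    _ ≤ (∑ i ∈ idx χ, w i * ‖F i.1 i.2‖ ^ 2) * ∑ i ∈ idx χ, w i * ‖G i.1 i.2‖ ^ 2 := h2
    _ = discMean c' χ F * discMean c' χ G := by rw [hF, hG]

/-- **The Cauchy–Schwarz floor:** with non-negative weights, `(√Ξ(F) − √Ξ(G))² ≤ Ξ(F + G)` — a cross term lowers the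
discrete mean of a sum at most to the floor, never below `0` (the (B1) reading of «bulk ⊕ band» for the wall class,
ls-ref-1 16:48:04Z). [cite: Zhang2022LandauSiegel, §2 Lemma 2.3, (2.15)–(2.17)] -/
theorem sq_sqrt_sub_sqrt_le_discMean_add
    (hw : ∀ i ∈ idx χ, 0 ≤ (cstar c' D i.1 i.2).re * (omegaW D i.2).re) (F G : Chr D → ℂ → ℂ) :
    (Real.sqrt (discMean c' χ F) - Real.sqrt (discMean c' χ G)) ^ 2 ≤
      discMean c' χ (fun x s => F x s + G x s) := by
  rw [discMean_add]
  have h := sq_sqrt_sub_sqrt_le (discMean_nonneg hw F) (discMean_nonneg hw G) (norm_sq_discPolar_le hw F G)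
  linarith

/-- In particular for a wall design: `Ξ(design) ≥ (√Ξ(bulk) − √Ξ(band))²` whenever the weights are `≥ 0`.
[cite: Zhang2022LandauSiegel, §2 Lemma 2.3, (2.15), §8 Lemma 8.1] -/
theorem discMean_wallDesign_ge
    (hw : ∀ i ∈ idx χ, 0 ≤ (cstar c' D i.1 i.2).re * (omegaW D i.2).re)
    (Λ : BandScale) (u : ℝ → ℂ) (W : WallData) :
    (Real.sqrt (discMean c' χ (wallBulkPoly χ u)) - Real.sqrt (discMean c' χ (wallBandPoly χ Λ W))) ^ 2 ≤
      discMean c' χ (fun x s =>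
        profPoly χ x (wallProfile ((Λ D χ) ^ (-(1 / 2 : ℝ))) (alphaTilde D) u W)
          ⌈bigP D ^ (1 + alphaTilde D)⌉₊ s) := by
  simp_rw [profPoly_wallProfile]
  exact sq_sqrt_sub_sqrt_le_discMean_add hw _ _

/-! ### Part 3 — registry rows E-006 and E-035 at the discrete-mean level (bare `Prop`s, none asserted) -/

/-- **E-006 «E*-cross» with a slot** (balanced reading): under (A), for every in-class kinked piece `u` and wall data
`W`, the bulk × band cross pairing of the realised design is `X(u,u',W)·𝔞𝔓 + o(𝔞𝔓)` — the asymptotic that makes the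
slot `X` of `KnifeEdgeWallBand.EMultiBand` the honest (A)-world limit of the cross. Status: derivation (HEURISTIC;
the registry's expectation is `X = 0`: `ECrossBand`). [cite: Zhang2022LandauSiegel, §8 Lemma 8.1, §2 (2.17)] -/
def ECrossBandAsymp (c' : ℝ) (Λ : BandScale) (X : WallCross) : Prop :=
  ∀ (u u' : ℝ → ℂ), KinkedProfile u u' → ∀ (W : WallData) (ε : ℝ), 0 < ε →
    ForAllLarge fun D _ χ => AssumptionA D χ →
      ‖discPolar c' χ (wallBulkPoly χ u) (wallBandPoly χ Λ W) - X u u' W * frakA χ * frakP D‖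
        ≤ ε * frakA χ * frakP D

/-- **E-006 «E*-cross» as expected by the registry — the cross term is `o(𝔞𝔓)`** («bulk × band cross term for
`g(1) ≠ 0` … expected `o(𝔅-scale)`»; status open-in-print-adjacent; nearest print = the typed Kloosterman-correlation
facts `Lit.fouvryKowalskiMichel2014_theorem117_typeII/_typeI`, `Lit.fouvryKowalskiMichel2014_corollary113`,
`Lit.kowalskiMichelSawin2017_theorem11/13` (p456463) and `Lit.fouvryKowalskiMichel2014_theorem15/17/115/116` (p456288),
none of which estimates THIS term; price L on paper / XL in Lean). The instance `X = 0` of `ECrossBandAsymp`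
(`eCrossBand_iff`). [cite: Zhang2022LandauSiegel, §8 Lemma 8.1, §2 (2.17)] -/
def ECrossBand (c' : ℝ) (Λ : BandScale) : Prop :=
  ∀ (u u' : ℝ → ℂ), KinkedProfile u u' → ∀ (W : WallData) (ε : ℝ), 0 < ε →
    ForAllLarge fun D _ χ => AssumptionA D χ →
      ‖discPolar c' χ (wallBulkPoly χ u) (wallBandPoly χ Λ W)‖ ≤ ε * frakA χ * frakP D

/-- **E-035 «E-cross-neg(κ)» at the discrete level** (registry v1.8, opened 16:48:50Z; status derivation not started;
price XL): some wall design has, under (A) and for all large `D`, a cross pairing `2Re Ξ(bulk, band) ≤ −κ·Ξ(bulk)` at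
band SATURATION `Ξ(band) = Ξ(bulk) > 0`. For `κ > 2` this is a `¬(A)` statement in disguise
(`theorem1_of_crossNegDiscrete`). [cite: Zhang2022LandauSiegel, §8 Lemma 8.1, §2 (2.17)] -/
def ECrossNegDiscrete (c' κ : ℝ) (Λ : BandScale) : Prop :=
  ∃ (u u' : ℝ → ℂ) (W : WallData), KinkedProfile u u' ∧
    ForAllLarge fun D _ χ => AssumptionA D χ →
      0 < discMean c' χ (wallBulkPoly χ u) ∧
      discMean c' χ (wallBandPoly χ Λ W) = discMean c' χ (wallBulkPoly χ u) ∧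
      2 * (discPolar c' χ (wallBulkPoly χ u) (wallBandPoly χ Λ W)).re ≤ -κ * discMean c' χ (wallBulkPoly χ u)

/-! ### Part 4 — PROVED: bookkeeping between the rows and the skeleton -/

section Bookkeeping

variable {c' : ℝ} {Λ : BandScale} {X : WallCross}

/-- `ECrossBand` is `ECrossBandAsymp` with the zero slot. [cite: Zhang2022LandauSiegel, §8 Lemma 8.1] -/
theorem eCrossBand_iff : ECrossBand c' Λ ↔ ECrossBandAsymp c' Λ 0 := by
  unfold ECrossBand ECrossBandAsymp
  simp only [Pi.zero_apply, zero_mul, sub_zero]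

/-- **E-035 with `κ > 2` contradicts Cauchy–Schwarz wherever the weights are non-negative**, hence — with Prop. 2.2 (i)
and Lemma 2.3 — it forces `¬(A)` for every real primitive character to every large modulus. (At saturation
`Ξ(band) = Ξ(bulk) = B > 0`: `|Ξ(bulk,band)| ≤ B` by `norm_sq_discPolar_le`, so `2Re Ξ(bulk,band) ≥ −2B > −κB`.)
[cite: Zhang2022LandauSiegel, §2 p. 6, Lemma 2.3, Prop. 2.2 (i), (2.15)–(2.17)] -/
theorem eventually_not_assumptionA_of_crossNegDiscrete {κ : ℝ} (hκ : 2 < κ) (h : ECrossNegDiscrete c' κ Λ)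
    (h22 : Prop22i) (h23 : Lemma23 c') :
    ∃ D₀ : ℕ, ∀ (D : ℕ) [NeZero D] (χ : DirichletCharacter ℂ D),
      D₀ ≤ D → χ.IsQuadratic → χ.IsPrimitive → ¬ AssumptionA D χ := by
  obtain ⟨u, u', W, _, hev⟩ := h
  obtain ⟨D₁, h₁⟩ := (hev.and h22).and h23
  refine ⟨max D₁ 3, fun D _ χ hD hq hp hA => ?_⟩
  have hD₁ : D₁ ≤ D := le_trans (le_max_left _ _) hD
  have hD3 : 3 ≤ D := le_trans (le_max_right _ _) hD
  obtain ⟨⟨hneg, h22'⟩, h23'⟩ := h₁ D χ hD₁ hq hp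
  obtain ⟨hB, hsat, hcross⟩ := hneg hA
  have hw := weights_nonneg_of hD3 h23' h22'
  set B := discMean c' χ (wallBulkPoly χ u) with hBdef
  set P := discPolar c' χ (wallBulkPoly χ u) (wallBandPoly χ Λ W) with hPdef
  have hcs : ‖P‖ ^ 2 ≤ B * B := by
    have := norm_sq_discPolar_le hw (wallBulkPoly χ u) (wallBandPoly χ Λ W)
    rwa [hsat] at this
  have hPB : ‖P‖ ≤ B := by nlinarith [norm_nonneg P, hB.le]
  have hre : -‖P‖ ≤ P.re := (abs_le.mp (Complex.abs_re_le_norm P)).1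
  nlinarith

/-- **E-035 (κ > 2) + Zhang's Part-1 zero model ⇒ Theorem 1 of the manuscript** — the row is as strong as the whole
endgame (its «XL» price, typed). Nothing is asserted: `ECrossNegDiscrete` is OPEN (prediction B-AH: false), `Prop22i`,
`Lemma23 c'` are CLAIMS of the manuscript. [cite: Zhang2022LandauSiegel, §2 p. 6, §1 Theorem 1] -/
theorem theorem1_of_crossNegDiscrete {κ : ℝ} (hκ : 2 < κ) (h : ECrossNegDiscrete c' κ Λ) (h22 : Prop22i)
    (h23 : Lemma23 c') : Theorem1 :=
  Skeleton.theorem1_of_eventually_not_assumptionA (eventually_not_assumptionA_of_crossNegDiscrete hκ h h22 h23)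

/-- **Slot consistency (finite form):** at a modulus where the weights are `≥ 0`, if the bulk, band and cross pairings
of a wall design are within `ε𝔞𝔓` of `𝔅·𝔞𝔓`, `V·𝔞𝔓`, `X·𝔞𝔓` respectively (`𝔞𝔓 > 0`), then the would-be constants
satisfy Cauchy–Schwarz up to the errors: `(|X| − ε)² ≤ (𝔅 + ε)(V + ε)` provided `ε ≤ |X|` — the inequality through
which any honest triple of (A)-world main terms inherits `|X|² ≤ 𝔅·V` (`KnifeEdgeWallBand.WallCrossCS`) as `ε → 0`.
[cite: Zhang2022LandauSiegel, §2 Lemma 2.3, (2.15)–(2.17)] -/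
theorem eCrossBandAsymp_cs {𝔅 V ε N : ℝ} {Xv : ℂ} (hN : 0 < N)
    (hw : ∀ i ∈ idx χ, 0 ≤ (cstar c' D i.1 i.2).re * (omegaW D i.2).re)
    {F G : Chr D → ℂ → ℂ}
    (hF : |discMean c' χ F - 𝔅 * N| ≤ ε * N) (hG : |discMean c' χ G - V * N| ≤ ε * N)
    (hX : ‖discPolar c' χ F G - Xv * N‖ ≤ ε * N) (hε : ε ≤ ‖Xv‖) :
    (‖Xv‖ - ε) ^ 2 ≤ (𝔅 + ε) * (V + ε) := by
  have hcs := norm_sq_discPolar_le hw F G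
  -- upper bounds for the two means, lower bound for the cross
  have hF' : discMean c' χ F ≤ (𝔅 + ε) * N := by
    have := (abs_le.mp hF).2; nlinarith
  have hG' : discMean c' χ G ≤ (V + ε) * N := by
    have := (abs_le.mp hG).2; nlinarith
  have hXN : ‖Xv * (N : ℂ)‖ = ‖Xv‖ * N := by
    rw [norm_mul, Complex.norm_real, Real.norm_eq_abs, abs_of_pos hN]
  have hX' : (‖Xv‖ - ε) * N ≤ ‖discPolar c' χ F G‖ := by
    have h1 : ‖Xv * (N : ℂ)‖ - ‖discPolar c' χ F G - Xv * N‖ ≤ ‖discPolar c' χ F G‖ := by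
      have := norm_sub_norm_le (Xv * (N : ℂ)) (Xv * N - discPolar c' χ F G)
      rw [sub_sub_cancel, norm_sub_rev] at this
      linarith
    rw [hXN] at h1
    nlinarith
  have h0 : 0 ≤ (‖Xv‖ - ε) * N := mul_nonneg (by linarith) hN.le
  have hsq : ((‖Xv‖ - ε) * N) ^ 2 ≤ ‖discPolar c' χ F G‖ ^ 2 := pow_le_pow_left₀ h0 hX' 2
  have hmF : 0 ≤ discMean c' χ F := discMean_nonneg hw F
  have hmG : 0 ≤ discMean c' χ G := discMean_nonneg hw G
  have hprod : discMean c' χ F * discMean c' χ G ≤ ((𝔅 + ε) * N) * ((V + ε) * N) :=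
    mul_le_mul hF' hG' hmG (le_trans hmF hF')
  have hNN : 0 < N ^ 2 := by positivity
  have key : ((‖Xv‖ - ε) * N) ^ 2 ≤ ((𝔅 + ε) * N) * ((V + ε) * N) := le_trans (le_trans hsq hcs) hprod
  have key' : (‖Xv‖ - ε) ^ 2 * N ^ 2 ≤ ((𝔅 + ε) * (V + ε)) * N ^ 2 := by
    have e1 : ((‖Xv‖ - ε) * N) ^ 2 = (‖Xv‖ - ε) ^ 2 * N ^ 2 := by ring
    have e2 : ((𝔅 + ε) * N) * ((V + ε) * N) = ((𝔅 + ε) * (V + ε)) * N ^ 2 := by ring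
    rw [← e1, ← e2]; exact key
  exact le_of_mul_le_mul_right key' hNN

end Bookkeeping

end KnifeEdge

end Literature.NumberTheory.LFunctions.Zhang2022
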